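import Mathlib
import HarnessLib
import Literature.MathematicalPhysics.QuantumLattice.LieTrotter

/-!
# Route `IntegerScrew` — the RESOLVENT of a finite matrix is the LAPLACE TRANSFORM of its exponential:
# `((a·1 − A)⁻¹)_{ij} = ∫₀^∞ e^{−at} (e^{tA})_{ij} dt` (PIVOT-LAW 13.10 (v), first half; the bridge between
# the per-window floor `1/f_M` of the intercept problem and the RETURN LAW of the multiplicative walk)

PIVOT-LAW §13.10 (v) (rh-explicit, A6-PIVOT theory) reads the vertex-1 entry of the resolvent of the
von Mangoldt coupling matrix `N_M` as a Laplace transform of a return probability: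
`[(a·I − N_M)⁻¹]₁₁ = ∫₀^∞ e^{−at} (e^{tN_M})₁₁ dt`; THEOREM N6₁ (PIVOT-LAW 13.45) feeds THEOREM C♯ (the
two-sided law of `(e^{τ·walkGen M})₁₁`, `IntegerScrewCSharpUpper.returnProb_csharp`) into the floor
through exactly this identity.  This file proves it as generic finite-dimensional analysis, ENTRYWISE
(real-valued integrals only), in three layers:

* `resolvent_mul_laplace_eq_one` / `inv_apply_eq_integral_laplace` — for ANY real square matrix `A` and
  real `a`: if every entry `Φ_{ij}(t) := e^{−at}(e^{tA})_{ij}` is integrable on `(0, ∞)` and tends to `0`,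
  then `(a·1 − A)·[∫₀^∞ Φ_{ij}]_{ij} = 1`, hence `((a·1 − A)⁻¹)_{ij} = ∫₀^∞ Φ_{ij}` and `a·1 − A` is
  invertible.  Proof: `Φ'_{ij} = −Σ_k (a·1 − A)_{ik} Φ_{kj}` (Kolmogorov's backward equation) and the
  fundamental theorem of calculus on `[0, ∞)` (`MeasureTheory.integral_Ioi_of_hasDerivAt_of_tendsto`).
* `laplaceHyp_of_growth` — an entrywise growth bound `|(e^{tA})_{kj}| ≤ C·e^{ωt}` (`t ≥ 0`) with `ω < a`
  supplies both hypotheses; `‖e^{tA}‖ ≤ e^{t‖A‖}` (ℓ^∞ operator norm) gives the case `‖A‖ < a`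
  (`inv_apply_eq_integral_laplace_of_norm_lt`).
* `norm_exp_smul_le_of_rowSum_le` — for a METZLER matrix `Q` (`Q_{ij} ≥ 0`, `i ≠ j`) with row sums
  `≤ ω`: `‖e^{tQ}‖ ≤ e^{ωt}` (`t ≥ 0`; shift `Q = B − λ·1`, `B ≥ 0` entrywise, `‖B‖ ≤ ω + λ`); hence
  `inv_apply_eq_integral_laplace_of_rowSum_le`: the resolvent identity for every `a > ω` — for a Markov
  GENERATOR (row sums `0`; e.g. `walkGen M` of `IntegerScrewWalkGenerator`) for every `a > 0`, and for a
  generator plus a diagonal potential `≤ ω` (the `ℰ`-tilt of 13.10) for every `a > ω` (Feynman–Kac rate).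

Generic linear algebra / real analysis (the `ℓ^∞` operator norm, `open scoped Matrix.Norms.Operator`,
appears only in the hypotheses of layers 2–3).  RH-free and walk-free: nothing here bears on the truth of
RH.  References: PIVOT-LAW §13.10 (v), §13.45 (rh-explicit A6-PIVOT); M. Suzuki, J. Lond. Math. Soc. (2)
108 (2023) 1448–1487 [Suzuki2023] for the screw matrices whose pivot law this serves; the identity is the
finite-dimensional case of the resolvent formula for semigroups (K.-J. Engel, R. Nagel, *One-Parameter
Semigroups for Linear Evolution Equations*, Thm II.1.10).
-/

noncomputable section

-- D-0017: `Summit.<S>.<S>.…` is the designed namespace of a single-problem summit.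
set_option linter.dupNamespace false

namespace Summit.RiemannHypothesis.RiemannHypothesis.Theorems.IntegerScrew

open scoped Matrix.Norms.Operator
open NormedSpace MeasureTheory Set Filter Topology Finset

variable {ι : Type*} [Fintype ι] [DecidableEq ι]

/-! ### Layer 1 — the identity under entrywise integrability -/

/-- Kolmogorov's BACKWARD equation, entrywise: `∂_t (e^{tA})_{ij} = Σ_k A_{ik} (e^{tA})_{kj}`. -/
theorem hasDerivAt_exp_smul_apply_left (A : Matrix ι ι ℝ) (t : ℝ) (i j : ι) :
    HasDerivAt (fun s : ℝ => (exp (s • A)) i j) (∑ k, A i k * (exp (t • A)) k j) t := by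
  have h := hasDerivAt_exp_smul_const' (𝕂 := ℝ) A t
  let L : Matrix ι ι ℝ →L[ℝ] ℝ := LinearMap.toContinuousLinearMap (Matrix.entryLinearMap ℝ ℝ i j)
  have hL : ∀ X : Matrix ι ι ℝ, L X = X i j := fun X => rfl
  have h2 := L.hasFDerivAt.comp_hasDerivAt t h
  have hfun : (fun s : ℝ => (exp (s • A)) i j) = (L : Matrix ι ι ℝ → ℝ) ∘ fun u : ℝ => exp (u • A) := by
    funext s
    simp only [Function.comp_apply, hL]
  rw [hfun]
  refine h2.congr_deriv ?_
  exact (hL _).trans Matrix.mul_apply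

/-- The entrywise Laplace kernel `Φ_{ij}(t) = e^{−at}(e^{tA})_{ij}` satisfies
`Φ'_{ij} = −Σ_k (a·1 − A)_{ik} Φ_{kj}`. -/
theorem hasDerivAt_laplace_exp_apply (A : Matrix ι ι ℝ) (a t : ℝ) (i j : ι) :
    HasDerivAt (fun s : ℝ => Real.exp (-(a * s)) * (exp (s • A)) i j)
      (-(∑ k, (a • (1 : Matrix ι ι ℝ) - A) i k * (Real.exp (-(a * t)) * (exp (t • A)) k j))) t := by
  have h1 : HasDerivAt (fun s : ℝ => Real.exp (-(a * s))) (Real.exp (-(a * t)) * (-a)) t := by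
    have h := ((hasDerivAt_id t).const_mul a).neg.exp
    simpa using h
  refine (h1.mul (hasDerivAt_exp_smul_apply_left A t i j)).congr_deriv ?_
  set c : ℝ := Real.exp (-(a * t)) with hc
  have e1 : ∑ k, (a • (1 : Matrix ι ι ℝ) - A) i k * (c * (exp (t • A)) k j) =
      a * (c * (exp (t • A)) i j) - ∑ k, A i k * (c * (exp (t • A)) k j) := by
    simp only [Matrix.sub_apply, Matrix.smul_apply, Matrix.one_apply, smul_eq_mul, sub_mul,
      Finset.sum_sub_distrib, mul_ite, mul_one, mul_zero, ite_mul, zero_mul, Finset.sum_ite_eq,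
      Finset.mem_univ, if_true]
  have e2 : ∑ k, A i k * (c * (exp (t • A)) k j) = c * ∑ k, A i k * (exp (t • A)) k j := by
    rw [Finset.mul_sum]
    exact Finset.sum_congr rfl fun k _ => by ring
  rw [e1, e2]
  ring

/-- The Laplace kernel is continuous in `t`. -/
theorem continuous_laplace_exp_apply (A : Matrix ι ι ℝ) (a : ℝ) (i j : ι) :
    Continuous fun s : ℝ => Real.exp (-(a * s)) * (exp (s • A)) i j :=
  continuous_iff_continuousAt.2 fun t => (hasDerivAt_laplace_exp_apply A a t i j).continuousAt

/-- **Resolvent identity, multiplicative form.**  If every entry `e^{−at}(e^{tA})_{kj}` is integrable on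
`(0, ∞)` and tends to `0`, then `Σ_k (a·1 − A)_{ik} ∫₀^∞ e^{−at}(e^{tA})_{kj} dt = δ_{ij}`. -/
theorem resolvent_mul_laplace_eq_one (A : Matrix ι ι ℝ) (a : ℝ)
    (hint : ∀ k j : ι, IntegrableOn (fun t : ℝ => Real.exp (-(a * t)) * (exp (t • A)) k j) (Ioi 0))
    (hlim : ∀ k j : ι, Tendsto (fun t : ℝ => Real.exp (-(a * t)) * (exp (t • A)) k j) atTop (𝓝 0)) :
    (a • (1 : Matrix ι ι ℝ) - A) *
        Matrix.of (fun k j => ∫ t in Ioi (0 : ℝ), Real.exp (-(a * t)) * (exp (t • A)) k j) = 1 := by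
  ext i j
  rw [Matrix.mul_apply]
  simp only [Matrix.of_apply]
  set B : Matrix ι ι ℝ := a • (1 : Matrix ι ι ℝ) - A with hB
  -- Σ_k B_ik ∫ Φ_kj = ∫ Σ_k B_ik Φ_kj = −∫ Φ'_ij = Φ_ij(0) − 0 = δ_ij
  have hsum : ∑ k, B i k * ∫ t in Ioi (0 : ℝ), Real.exp (-(a * t)) * (exp (t • A)) k j =
      ∫ t in Ioi (0 : ℝ), ∑ k, B i k * (Real.exp (-(a * t)) * (exp (t • A)) k j) := by
    rw [integral_finsetSum _ fun k _ => (hint k j).const_mul (B i k)]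
    refine Finset.sum_congr rfl fun k _ => ?_
    exact (integral_const_mul (μ := volume.restrict (Ioi (0 : ℝ))) (B i k) _).symm
  rw [hsum]
  have hint' : IntegrableOn
      (fun t : ℝ => -(∑ k, B i k * (Real.exp (-(a * t)) * (exp (t • A)) k j))) (Ioi 0) :=
    (integrable_finsetSum _ fun k _ => (hint k j).const_mul (B i k)).neg
  have hFTC := integral_Ioi_of_hasDerivAt_of_tendsto
    (f := fun s : ℝ => Real.exp (-(a * s)) * (exp (s • A)) i j) (a := 0)
    (continuous_laplace_exp_apply A a i j).continuousWithinAt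
    (fun x _ => hasDerivAt_laplace_exp_apply A a x i j) hint' (hlim i j)
  rw [integral_neg, mul_zero, neg_zero, Real.exp_zero, one_mul, zero_smul, exp_zero, zero_sub,
    neg_inj] at hFTC
  rw [hFTC, Matrix.one_apply]

/-- Under the hypotheses of `resolvent_mul_laplace_eq_one`, `a·1 − A` is invertible. -/
theorem isUnit_resolvent_of_laplace (A : Matrix ι ι ℝ) (a : ℝ)
    (hint : ∀ k j : ι, IntegrableOn (fun t : ℝ => Real.exp (-(a * t)) * (exp (t • A)) k j) (Ioi 0))
    (hlim : ∀ k j : ι, Tendsto (fun t : ℝ => Real.exp (-(a * t)) * (exp (t • A)) k j) atTop (𝓝 0)) :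
    IsUnit (a • (1 : Matrix ι ι ℝ) - A) :=
  IsUnit.of_mul_eq_one _ (resolvent_mul_laplace_eq_one A a hint hlim)

/-- **The resolvent is the Laplace transform of the matrix exponential** (entrywise):
`((a·1 − A)⁻¹)_{ij} = ∫₀^∞ e^{−at} (e^{tA})_{ij} dt`, provided every entry of the integrand is integrable
on `(0, ∞)` and tends to `0`. -/
theorem inv_apply_eq_integral_laplace (A : Matrix ι ι ℝ) (a : ℝ)
    (hint : ∀ k j : ι, IntegrableOn (fun t : ℝ => Real.exp (-(a * t)) * (exp (t • A)) k j) (Ioi 0))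
    (hlim : ∀ k j : ι, Tendsto (fun t : ℝ => Real.exp (-(a * t)) * (exp (t • A)) k j) atTop (𝓝 0))
    (i j : ι) :
    ((a • (1 : Matrix ι ι ℝ) - A)⁻¹) i j = ∫ t in Ioi (0 : ℝ), Real.exp (-(a * t)) * (exp (t • A)) i j := by
  rw [Matrix.inv_eq_right_inv (resolvent_mul_laplace_eq_one A a hint hlim), Matrix.of_apply]

/-- An ℓ^∞-operator-norm bound `‖X‖ ≤ r` bounds every entry: `|X_{ij}| ≤ r`. -/
theorem abs_apply_le_of_norm_le {X : Matrix ι ι ℝ} {r : ℝ} (h : ‖X‖ ≤ r) (i j : ι) : |X i j| ≤ r := by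
  refine le_trans ?_ h
  rw [Matrix.linfty_opNorm_def]
  have h1 : ‖X i j‖₊ ≤ ∑ k, ‖X i k‖₊ :=
    Finset.single_le_sum (f := fun k => ‖X i k‖₊) (fun k _ => bot_le) (Finset.mem_univ j)
  have h2 : (∑ k, ‖X i k‖₊) ≤ Finset.univ.sup fun i' => ∑ k, ‖X i' k‖₊ :=
    Finset.le_sup (f := fun i' => ∑ k, ‖X i' k‖₊) (Finset.mem_univ i)
  have h3 : ((‖X i j‖₊ : NNReal) : ℝ) ≤ ((Finset.univ.sup fun i' => ∑ k, ‖X i' k‖₊ : NNReal) : ℝ) := by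
    exact_mod_cast h1.trans h2
  rwa [coe_nnnorm, Real.norm_eq_abs] at h3

/-! ### Layer 2 — growth bounds that supply the hypotheses -/

/-- An entrywise growth bound `|(e^{tA})_{kj}| ≤ C·e^{ωt}` on `t ≥ 0` with `ω < a` makes every entry of the
Laplace kernel `e^{−at}(e^{tA})_{kj}` integrable on `(0, ∞)` and tending to `0` (no norm involved). -/
theorem laplaceHyp_of_growth (A : Matrix ι ι ℝ) {a ω C : ℝ} (hω : ω < a)
    (hgrowth : ∀ t : ℝ, 0 ≤ t → ∀ k j : ι, |(exp (t • A)) k j| ≤ C * Real.exp (ω * t)) :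
    (∀ k j : ι, IntegrableOn (fun t : ℝ => Real.exp (-(a * t)) * (exp (t • A)) k j) (Ioi 0)) ∧
      ∀ k j : ι, Tendsto (fun t : ℝ => Real.exp (-(a * t)) * (exp (t • A)) k j) atTop (𝓝 0) := by
  have hbound : ∀ (k j : ι) (t : ℝ), 0 ≤ t →
      ‖Real.exp (-(a * t)) * (exp (t • A)) k j‖ ≤ C * Real.exp (-(a - ω) * t) := by
    intro k j t ht
    rw [norm_mul, Real.norm_of_nonneg (Real.exp_pos _).le, Real.norm_eq_abs]
    calc Real.exp (-(a * t)) * |(exp (t • A)) k j|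
        ≤ Real.exp (-(a * t)) * (C * Real.exp (ω * t)) :=
          mul_le_mul_of_nonneg_left (hgrowth t ht k j) (Real.exp_pos _).le
      _ = C * Real.exp (-(a - ω) * t) := by
          rw [mul_left_comm, ← Real.exp_add]; ring_nf
  refine ⟨fun k j => ?_, fun k j => ?_⟩
  · have hg : IntegrableOn (fun t : ℝ => C * Real.exp (-(a - ω) * t)) (Ioi 0) :=
      (exp_neg_integrableOn_Ioi 0 (sub_pos.2 hω)).const_mul C
    refine Integrable.mono' hg
      (continuous_laplace_exp_apply A a k j).aestronglyMeasurable.restrict ?_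
    refine (ae_restrict_iff' measurableSet_Ioi).2 (Filter.Eventually.of_forall fun t ht => ?_)
    exact hbound k j t (le_of_lt ht)
  · have hto : Tendsto (fun t : ℝ => C * Real.exp (-(a - ω) * t)) atTop (𝓝 0) := by
      have h1 : Tendsto (fun t : ℝ => Real.exp (-(a - ω) * t)) atTop (𝓝 0) :=
        Real.tendsto_exp_atBot.comp
          (tendsto_id.const_mul_atTop_of_neg (by linarith : -(a - ω) < 0))
      simpa using h1.const_mul C
    refine squeeze_zero_norm' ?_ hto
    filter_upwards [eventually_ge_atTop (0 : ℝ)] with t ht using hbound k j t ht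


section Norm

variable [Nonempty ι]

/-- `‖e^{tA}‖ ≤ e^{t‖A‖}` for `t ≥ 0` (ℓ^∞ operator norm). -/
theorem norm_exp_smul_le_exp_mul_norm (A : Matrix ι ι ℝ) {t : ℝ} (ht : 0 ≤ t) :
    ‖exp (t • A)‖ ≤ Real.exp (t * ‖A‖) := by
  have h := Literature.MathematicalPhysics.QuantumLattice.norm_exp_le ℝ (t • A)
  rwa [norm_smul, Real.norm_of_nonneg ht] at h

/-- **Resolvent = Laplace transform, norm form**: if `‖A‖ < a` (ℓ^∞ operator norm = maximal absolute
row sum), then `((a·1 − A)⁻¹)_{ij} = ∫₀^∞ e^{−at}(e^{tA})_{ij} dt`. -/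
theorem inv_apply_eq_integral_laplace_of_norm_lt (A : Matrix ι ι ℝ) {a : ℝ} (ha : ‖A‖ < a)
    (i j : ι) :
    ((a • (1 : Matrix ι ι ℝ) - A)⁻¹) i j = ∫ t in Ioi (0 : ℝ), Real.exp (-(a * t)) * (exp (t • A)) i j := by
  have h := laplaceHyp_of_growth A (C := 1) ha fun t ht k j => by
    rw [one_mul, mul_comm]; exact abs_apply_le_of_norm_le (norm_exp_smul_le_exp_mul_norm A ht) k j
  exact inv_apply_eq_integral_laplace A a h.1 h.2 i j

/-- `‖A‖ < a ⇒ a·1 − A` is invertible. -/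
theorem isUnit_resolvent_of_norm_lt (A : Matrix ι ι ℝ) {a : ℝ} (ha : ‖A‖ < a) :
    IsUnit (a • (1 : Matrix ι ι ℝ) - A) := by
  have h := laplaceHyp_of_growth A (C := 1) ha fun t ht k j => by
    rw [one_mul, mul_comm]; exact abs_apply_le_of_norm_le (norm_exp_smul_le_exp_mul_norm A ht) k j
  exact isUnit_resolvent_of_laplace A a h.1 h.2

/-! ### Layer 3 — Metzler matrices (Markov generators with a potential): growth rate = max row sum -/

/-- The ℓ^∞ operator norm of an entrywise non-negative matrix with row sums `≤ r` is `≤ r`. -/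
theorem norm_le_of_nonneg_of_rowSum_le (B : Matrix ι ι ℝ) {r : ℝ} (hB : ∀ i j, 0 ≤ B i j)
    (hrow : ∀ i, ∑ j, B i j ≤ r) : ‖B‖ ≤ r := by
  have hr : 0 ≤ r := by
    obtain ⟨i⟩ := (inferInstance : Nonempty ι)
    exact (Finset.sum_nonneg fun j _ => hB i j).trans (hrow i)
  lift r to NNReal using hr
  rw [Matrix.linfty_opNorm_def]
  have h : ∀ i, (∑ j, ‖B i j‖₊ : NNReal) ≤ r := by
    intro i
    have e : ((∑ j, ‖B i j‖₊ : NNReal) : ℝ) = ∑ j, B i j := by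
      rw [NNReal.coe_sum]
      exact Finset.sum_congr rfl fun j _ => by rw [coe_nnnorm, Real.norm_of_nonneg (hB i j)]
    exact_mod_cast (e.le.trans (hrow i))
  exact_mod_cast (Finset.sup_le fun i _ => h i)

/-- **Growth bound for a Metzler matrix.**  If `Q_{ij} ≥ 0` for `i ≠ j` and every row sum of `Q` is
`≤ ω`, then `‖e^{tQ}‖ ≤ e^{ωt}` for `t ≥ 0` (for a Markov generator `ω = 0`: `e^{tQ}` is a sup-norm
contraction; for generator + diagonal potential `V`, `ω = max V`: the Feynman–Kac rate). -/
theorem norm_exp_smul_le_of_rowSum_le (Q : Matrix ι ι ℝ) {ω : ℝ} (hQ : ∀ i j, i ≠ j → 0 ≤ Q i j)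
    (hrow : ∀ i, ∑ j, Q i j ≤ ω) {t : ℝ} (ht : 0 ≤ t) :
    ‖exp (t • Q)‖ ≤ Real.exp (ω * t) := by
  -- shift: λ := Σ_k |Q_kk| dominates every −Q_ii
  set lam : ℝ := ∑ k, |Q k k| with hlam
  set B : Matrix ι ι ℝ := Q + lam • (1 : Matrix ι ι ℝ) with hBdef
  have hBnn : ∀ i j, 0 ≤ B i j := by
    intro i j
    rw [hBdef, Matrix.add_apply, Matrix.smul_apply, smul_eq_mul, Matrix.one_apply]
    by_cases hij : i = j
    · subst hij
      rw [if_pos rfl, mul_one]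
      have h1 : |Q i i| ≤ lam := by
        rw [hlam]
        exact Finset.single_le_sum (f := fun k => |Q k k|) (fun k _ => abs_nonneg _)
          (Finset.mem_univ i)
      have h2 : -Q i i ≤ |Q i i| := neg_le_abs _
      linarith
    · rw [if_neg hij, mul_zero, add_zero]
      exact hQ i j hij
  have hBrow : ∀ i, ∑ j, B i j ≤ ω + lam := by
    intro i
    have e : ∑ j, B i j = ∑ j, Q i j + lam := by
      rw [hBdef]
      simp only [Matrix.add_apply, Matrix.smul_apply, smul_eq_mul, Matrix.one_apply, mul_ite, mul_one,
        mul_zero, Finset.sum_add_distrib, Finset.sum_ite_eq, Finset.mem_univ, if_true]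
    rw [e]
    linarith [hrow i]
  have hBnorm : ‖B‖ ≤ ω + lam := norm_le_of_nonneg_of_rowSum_le B hBnn hBrow
  have hsplit : t • Q = t • B + (-(t * lam)) • (1 : Matrix ι ι ℝ) := by
    rw [hBdef, smul_add, smul_smul, neg_smul, ← sub_eq_add_neg, add_sub_cancel_right]
  have hcomm : Commute (t • B) ((-(t * lam)) • (1 : Matrix ι ι ℝ)) :=
    (Commute.one_right _).smul_right _
  -- `e^{c·1} = e^c·1`: scalars pass through the exponential (`algebraMap_exp_comm`)
  have hone : exp ((-(t * lam)) • (1 : Matrix ι ι ℝ)) = Real.exp (-(t * lam)) • (1 : Matrix ι ι ℝ) := by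
    have h2 := NormedSpace.algebraMap_exp_comm (𝔸 := Matrix ι ι ℝ) (-(t * lam))
    simp only [Algebra.algebraMap_eq_smul_one] at h2
    rw [Real.exp_eq_exp_ℝ]
    convert h2.symm using 2 <;> rfl
  rw [hsplit, Matrix.exp_add_of_commute _ _ hcomm, hone, Matrix.mul_smul, mul_one,
    norm_smul, Real.norm_of_nonneg (Real.exp_pos _).le]
  calc Real.exp (-(t * lam)) * ‖exp (t • B)‖
      ≤ Real.exp (-(t * lam)) * Real.exp (t * ‖B‖) :=
        mul_le_mul_of_nonneg_left (norm_exp_smul_le_exp_mul_norm B ht) (Real.exp_pos _).le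
    _ ≤ Real.exp (-(t * lam)) * Real.exp (t * (ω + lam)) :=
        mul_le_mul_of_nonneg_left (Real.exp_le_exp.2 (mul_le_mul_of_nonneg_left hBnorm ht))
          (Real.exp_pos _).le
    _ = Real.exp (ω * t) := by rw [← Real.exp_add]; ring_nf

/-- **Resolvent = Laplace transform for a Metzler matrix** (`Q_{ij} ≥ 0` off the diagonal, row sums
`≤ ω`): for every `a > ω`, `((a·1 − Q)⁻¹)_{ij} = ∫₀^∞ e^{−at}(e^{tQ})_{ij} dt` — PIVOT-LAW 13.10 (v): the
resolvent entry is the Laplace transform of the transition function `t ↦ (e^{tQ})_{ij}` of the walk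
generated by `Q`.  For a Markov generator (row sums `0`) this holds for every `a > 0`. -/
theorem inv_apply_eq_integral_laplace_of_rowSum_le (Q : Matrix ι ι ℝ) {ω a : ℝ}
    (hQ : ∀ i j, i ≠ j → 0 ≤ Q i j) (hrow : ∀ i, ∑ j, Q i j ≤ ω) (ha : ω < a) (i j : ι) :
    ((a • (1 : Matrix ι ι ℝ) - Q)⁻¹) i j = ∫ t in Ioi (0 : ℝ), Real.exp (-(a * t)) * (exp (t • Q)) i j := by
  have h := laplaceHyp_of_growth Q (C := 1) ha fun t ht k j => by
    rw [one_mul]; exact abs_apply_le_of_norm_le (norm_exp_smul_le_of_rowSum_le Q hQ hrow ht) k j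
  exact inv_apply_eq_integral_laplace Q a h.1 h.2 i j

/-- `a·1 − Q` is invertible for `a > ω ≥` the row sums of a Metzler matrix `Q` (in particular for every
`a > 0` when `Q` is a Markov generator). -/
theorem isUnit_resolvent_of_rowSum_le (Q : Matrix ι ι ℝ) {ω a : ℝ}
    (hQ : ∀ i j, i ≠ j → 0 ≤ Q i j) (hrow : ∀ i, ∑ j, Q i j ≤ ω) (ha : ω < a) :
    IsUnit (a • (1 : Matrix ι ι ℝ) - Q) := by
  have h := laplaceHyp_of_growth Q (C := 1) ha fun t ht k j => by
    rw [one_mul]; exact abs_apply_le_of_norm_le (norm_exp_smul_le_of_rowSum_le Q hQ hrow ht) k j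
  exact isUnit_resolvent_of_laplace Q a h.1 h.2

/-- The entries of `e^{tQ}` for a Metzler `Q` with row sums `≤ ω` are bounded by `e^{ωt}` in absolute
value (`t ≥ 0`); for a Markov generator, by `1`. -/
theorem abs_exp_smul_apply_le_of_rowSum_le (Q : Matrix ι ι ℝ) {ω : ℝ}
    (hQ : ∀ i j, i ≠ j → 0 ≤ Q i j) (hrow : ∀ i, ∑ j, Q i j ≤ ω) {t : ℝ} (ht : 0 ≤ t) (i j : ι) :
    |(exp (t • Q)) i j| ≤ Real.exp (ω * t) :=
  abs_apply_le_of_norm_le (norm_exp_smul_le_of_rowSum_le Q hQ hrow ht) i j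

end Norm

end Summit.RiemannHypothesis.RiemannHypothesis.Theorems.IntegerScrew

end
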